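import Literature.NumberTheory.DiophantineGeometry.AbcShapeGeometrySets
import Literature.NumberTheory.DiophantineGeometry.AbcShapeSubBox

-- Summit.ABC.ABC is the mandated summit-side namespace (single-conjunct summit); the lakefile sets the same option tree-wide.
set_option linter.dupNamespace false

/-!
# Fibring the shape count over the host `z`-coordinates outside `Q` (crux stmt-ABC-2757, stub `de_shapeCount_le_fibre_hostZ`)

Stub W5c of the DE tool for the line `critical-kloosterman-powerful-moduli` of the crux
`Summit.ABC.ABC.Theses.TwistAmplification.MazurKaneLaw`.  This is the host-`z` variant of
`Summit.ABC.ABC.Theorems.MazurKaneLaw.de_shapeCount_le_fibre`: the shape count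
`B_d = AbcShapes.shapeCount c₁ c₂ c₃ X Y Z` counts the `(x, y, z)` in the dyadic boxes
`[X, 2X) × [Y, 2Y) × [Z, 2Z)` with `c₁ ∏ xⱼ^{j+1} + c₂ ∏ yⱼ^{j+1} = c₃ ∏ zⱼ^{j+1}` and
`gcd(c₁ ∏ xⱼ, c₂ ∏ yⱼ, c₃ ∏ zⱼ) = 1`.  Here the DE tool reads its modulus
`W_Q(z) = ∏_{i∈Q} zᵢ^{i+1}` (`AbcShapes.onVal Q z`) off the `z`-term (the right-hand side); this file
(`Summit.ABC.ABC.Theorems.MazurKaneLaw.de_shapeCount_le_fibre_hostZ`) forgets the `z`-coordinates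
outside `Q` at a cost `Dτ^d`:

* map a solution `(x, y, z) ↦ ((x, y), freezeOn Qᶜ Z z)`; the image lies in
  `(box X × box Y) × subBox Qᶜ Z` and satisfies: `W_Q(z)` is coprime to `c₁ V(x)` and to `c₂ V(y)`
  (it divides `c₃ V(z) = c₁ V(x) + c₂ V(y)`, which is coprime to both since
  `gcd(c₁ V(x), c₂ V(y)) = 1` by `AbcShapes.coprime_terms_of_mem`) and `W_Q(z) ∣ c₁ V(x) + c₂ V(y)`;
* two solutions with the same image share `(x, y)`, hence the value `m = V(z) ≤ T` (`c₃ ≥ 1`), and on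
  such a fibre `z ↦ freezeOn Q Z z` is injective with values among the tuples of `subBox Q Z` whose
  free coordinates divide `m`: at most `τ(m)^d ≤ Dτ^d` of them (`AbcShapes.card_subBox_filter_dvd_le`);
* hence `B_d ≤ Dτ^d · #image ≤ Dτ^d · #(filtered target set)` (`Finset.card_le_mul_card_image`).

No new definitions.
-/

namespace Summit.ABC.ABC.Theorems.MazurKaneLaw

open Finset
open Literature.NumberTheory.DiophantineGeometry
open Literature.NumberTheory.DiophantineGeometry.AbcShapes

/-- **Fibring the shape count over the host `z`-coordinates outside `Q`** (stub W5c
`de_shapeCount_le_fibre_hostZ` of the DE tool, line `critical-kloosterman-powerful-moduli`): for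
positive `cᵢ`, boxes with positive parameters, `T ≥ c₃ ∏ⱼ (2Zⱼ)^{j+1}`, `τ(m) ≤ Dτ` for `1 ≤ m ≤ T`
and a set `Q` of coordinates,
`B_d ≤ Dτ^d · #{((x, y), r) ∈ (box X × box Y) × subBox Qᶜ Z : gcd(W_Q(r), c₁V(x)) = gcd(W_Q(r), c₂V(y)) = 1,`
`W_Q(r) ∣ c₁V(x) + c₂V(y)}`.
Proof: send a solution `(x, y, z)` to `((x, y), freezeOn Qᶜ Z z)` (the image satisfies the three
conditions since `W_Q(z) ∣ c₃V(z) = c₁V(x) + c₂V(y)` and the terms are pairwise coprime); on a fibre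
`(x, y)` is fixed, so `V(z) = m` is fixed (`c₃ ≥ 1`), `m ≠ 0`, `m ≤ T`, and `z ↦ freezeOn Q Z z` is
injective into the tuples of `subBox Q Z` whose free coordinates divide `m`, at most `τ(m)^d ≤ Dτ^d`
of them (`AbcShapes.card_subBox_filter_dvd_le`); conclude with `Finset.card_le_mul_card_image`.
[folklore] -/
theorem de_shapeCount_le_fibre_hostZ : ∀ {d : ℕ} {c₁ c₂ c₃ : ℕ}, 0 < c₁ → 0 < c₂ → 0 < c₃ → ∀ (X Y Z : Fin d → ℕ), (∀ j, 0 < X j) → (∀ j, 0 < Y j) → (∀ j, 0 < Z j) → ∀ {T Dτ : ℕ}, c₃ * shapeVal (fun j => 2 * Z j) ≤ T → (∀ m : ℕ, m ≠ 0 → m ≤ T → m.divisors.card ≤ Dτ) → ∀ (Q : Finset (Fin d)), (shapeCount c₁ c₂ c₃ X Y Z : ℝ) ≤ (Dτ : ℝ) ^ d * ((((dyadicBox X ×ˢ dyadicBox Y) ×ˢ subBox Qᶜ Z).filter (fun t : ((Fin d → ℕ) × (Fin d → ℕ)) × (Fin d → ℕ) => Nat.Coprime (onVal Q t.2) (c₁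 * shapeVal t.1.1) ∧ Nat.Coprime (onVal Q t.2) (c₂ * shapeVal t.1.2) ∧ ((onVal Q t.2 : ℕ) : ℤ) ∣ ((c₁ * shapeVal t.1.1 : ℕ) : ℤ) + ((c₂ * shapeVal t.1.2 : ℕ) : ℤ))).card : ℝ) := by
  intro d c₁ c₂ c₃ _hc₁ _hc₂ hc₃ X Y Z _hX _hY hZ T Dτ hTZ hD Q
  set F := shapeTriples c₁ c₂ c₃ X Y Z
  set ψ : (Fin d → ℕ) × (Fin d → ℕ) × (Fin d → ℕ) → ((Fin d → ℕ) × (Fin d → ℕ)) × (Fin d → ℕ) :=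
    fun t => ((t.1, t.2.1), freezeOn Qᶜ Z t.2.2) with hψ
  -- what membership in `F` means
  have hmem : ∀ t ∈ F, (t.1 ∈ dyadicBox X ∧ t.2.1 ∈ dyadicBox Y ∧ t.2.2 ∈ dyadicBox Z) ∧
      c₁ * shapeVal t.1 + c₂ * shapeVal t.2.1 = c₃ * shapeVal t.2.2 ∧
      Nat.Coprime (c₁ * shapeVal t.1) (c₂ * shapeVal t.2.1) := by
    intro t ht
    have hcop := coprime_terms_of_mem ht
    obtain ⟨hbox, heq, -⟩ := mem_filter.mp ht
    exact ⟨by simpa only [mem_product] using hbox, heq, hcop⟩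
  -- (a) each fibre of `ψ` has at most `Dτ^d` elements
  have hfib : F.card ≤ Dτ ^ d * (F.image ψ).card := by
    refine card_le_mul_card_image F (Dτ ^ d) fun w hw => ?_
    obtain ⟨t₁, ht₁, rfl⟩ := mem_image.mp hw
    obtain ⟨⟨-, -, hbz₁⟩, heq₁, -⟩ := hmem t₁ ht₁
    have hz₁ := mem_dyadicBox.mp hbz₁
    set m : ℕ := shapeVal t₁.2.2
    have hm0 : m ≠ 0 := (shapeVal_pos fun j => lt_of_lt_of_le (hZ j) (hz₁ j).1).ne'
    have hmT : m ≤ T :=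
      (shapeVal_mono fun j => (hz₁ j).2.le).trans ((Nat.le_mul_of_pos_left _ hc₃).trans hTZ)
    -- the tuples of `subBox Q Z` whose free coordinates divide `m`
    have hcount : ((subBox Q Z).filter (fun s => offVal Q s ∣ m)).card ≤ Dτ ^ d :=
      (card_subBox_filter_dvd_le Q Z hm0 (fun s => offVal Q s ∣ m)
        fun s _ hs i hi => (dvd_offVal Q s hi).trans hs).trans (Nat.pow_le_pow_left (hD m hm0 hmT) d)
    refine le_trans ?_ hcount
    -- on the fibre, `(x, y) = (x₁, y₁)`, hence `V(z) = m`, and the `Q`-coordinates of `z` are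
    -- those of `z₁`
    have hfm : ∀ t ∈ F.filter (fun t => ψ t = ψ t₁), t.2.2 ∈ dyadicBox Z ∧
        freezeOn Qᶜ Z t.2.2 = freezeOn Qᶜ Z t₁.2.2 ∧ t.1 = t₁.1 ∧ t.2.1 = t₁.2.1 ∧
          shapeVal t.2.2 = m := by
      intro t ht
      obtain ⟨htF, hψt⟩ := mem_filter.mp ht
      obtain ⟨⟨-, -, hbz⟩, heq, -⟩ := hmem t htF
      simp only [hψ, Prod.mk.injEq] at hψt
      obtain ⟨⟨h1, h2⟩, h3⟩ := hψt
      refine ⟨hbz, h3, h1, h2, Nat.eq_of_mul_eq_mul_left hc₃ ?_⟩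
      rw [← heq, ← heq₁, h1, h2]
    refine card_le_card_of_injOn (fun t => freezeOn Q Z t.2.2) (fun t ht => ?_)
      (fun t ht t' ht' h => ?_)
    · obtain ⟨hbz, -, -, -, hval⟩ := hfm t (mem_coe.mp ht)
      refine mem_coe.mpr (mem_filter.mpr ⟨freezeOn_mem_subBox Q hbz, ?_⟩)
      rw [offVal_freezeOn, ← hval, shapeVal_eq_offVal_mul_onVal Q t.2.2]
      exact dvd_mul_right _ _
    · obtain ⟨-, f1, f2, f3, -⟩ := hfm t (mem_coe.mp ht)
      obtain ⟨-, f1', f2', f3', -⟩ := hfm t' (mem_coe.mp ht')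
      dsimp only at h
      refine Prod.ext (f2.trans f2'.symm) (Prod.ext (f3.trans f3'.symm) ?_)
      rw [← mergeOn_freezeOn Q Z t.2.2, ← mergeOn_freezeOn Q Z t'.2.2, f1, f1', h]
  -- (b) the image lies in the target set
  have himg : (F.image ψ).card ≤ (((dyadicBox X ×ˢ dyadicBox Y) ×ˢ subBox Qᶜ Z).filter
      (fun t : ((Fin d → ℕ) × (Fin d → ℕ)) × (Fin d → ℕ) =>
        Nat.Coprime (onVal Q t.2) (c₁ * shapeVal t.1.1) ∧ Nat.Coprime (onVal Q t.2) (c₂ * shapeVal t.1.2) ∧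
          ((onVal Q t.2 : ℕ) : ℤ) ∣ ((c₁ * shapeVal t.1.1 : ℕ) : ℤ) + ((c₂ * shapeVal t.1.2 : ℕ) : ℤ))).card := by
    refine card_le_card fun w hw => ?_
    obtain ⟨t, htF, rfl⟩ := mem_image.mp hw
    obtain ⟨⟨hbx, hby, hbz⟩, heq, hcop⟩ := hmem t htF
    have hd3 : onVal Q t.2.2 ∣ c₁ * shapeVal t.1 + c₂ * shapeVal t.2.1 := by
      rw [heq, shapeVal_eq_offVal_mul_onVal Q t.2.2]; exact ⟨c₃ * offVal Q t.2.2, by ring⟩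
    have h31 : Nat.Coprime (onVal Q t.2.2) (c₁ * shapeVal t.1) :=
      (Nat.coprime_self_add_left.mpr hcop.symm).coprime_dvd_left hd3
    have h32 : Nat.Coprime (onVal Q t.2.2) (c₂ * shapeVal t.2.1) :=
      (Nat.coprime_add_self_left.mpr hcop).coprime_dvd_left hd3
    have hdvd : ((onVal Q t.2.2 : ℕ) : ℤ) ∣
        ((c₁ * shapeVal t.1 : ℕ) : ℤ) + ((c₂ * shapeVal t.2.1 : ℕ) : ℤ) := by
      rw [← Nat.cast_add]
      exact Int.natCast_dvd_natCast.mpr hd3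
    refine mem_filter.mpr
      ⟨mem_product.mpr ⟨mem_product.mpr ⟨hbx, hby⟩, freezeOn_mem_subBox Qᶜ hbz⟩, ?_⟩
    simp only [hψ, onVal_freezeOn_compl]
    exact ⟨h31, h32, hdvd⟩
  -- (c) assemble
  calc (shapeCount c₁ c₂ c₃ X Y Z : ℝ) = (F.card : ℝ) := rfl
    _ ≤ (Dτ : ℝ) ^ d * ((F.image ψ).card : ℝ) := by exact_mod_cast hfib
    _ ≤ _ := mul_le_mul_of_nonneg_left (Nat.cast_le.mpr himg) (by positivity)

end Summit.ABC.ABC.Theorems.MazurKaneLaw
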